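import Summits.MatrixMultiplication.MatrixMultiplication.Theorems.SaturationLadderFlatFormats
import Summits.MatrixMultiplication.MatrixMultiplication.Theorems.SaturationLadderGradeOneThirdCert
import Summits.MatrixMultiplication.MatrixMultiplication.Theorems.SaturationLadderAlphaTwoSevenths
import HarnessLib

/-!
# Route `SaturationLadder` — flat formats, chain file 2/2: the route's items as flatness of matrix
multiplication formats, BY NAME, and the tree's unconditionally flat formats (decomp-mm lens 1, gen 26)

Chain file 1 (`SaturationLadderFlatFormats`, route-free) made the gauge floor base-free and proved the dictionary
`φ₁(⟨p^a,p^b,p^c⟩) = ω(a,b,c)/(a+c)`, `⟨p^a,p^b,p^c⟩ flat ⟺ ω(a,b,c) = a + c` (tight).  This file (which imports the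
route's item types through the landed kernels it cites, hence is not route-free) records:
* §1 the items of `route-MatrixMultiplication-SaturationLadder` in flatness currency, by name: `E_k ⟺ ⟨p^k,p,p⟩ flat`
  (`farExact_iff_flat`); **`TailDescentTwo` (stmt-29474) ⟺ «some `⟨p^k,p,p⟩`, `k ≥ 3`, flat ⟹ `⟨p²,p,p⟩` flat»**;
  **`SquareFromTwo` (stmt-29475, declared residual) ⟺ «`⟨p²,p,p⟩` flat ⟹ `⟨p,p,p⟩` flat»**; the summit ⟺ `⟨p,p,p⟩` flat;
  the thin points `ω(1,b/a,c/a) = 1 + c/a` of `SubexpSaturation` (stmt-25909) ⟺ `⟨p^a,p^b,p^c⟩` flat (any `p ≥ 2`).  So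
  the route is a chain of FLAT-TO-FLAT transfers between matrix multiplication formats, `thin/far ⟶ ⟨p²,p,p⟩ ⟶ ⟨p,p,p⟩`,
  exactly the transfers chain file 1's floor permits (`base_tight_of_exact`: exact certification needs a tight base; on a
  flat base the floor is silent) — the floor prices the crux side and does not obstruct the residual side.
* §2 the tree's UNCONDITIONALLY TIGHT formats as flat tensors — instances of Strassen's asymptotic rank conjecture for
  matrix multiplication tensors, `R̃(⟨p^a,p^b,p^c⟩) = p^{a+c}` for all `p ≥ 2`: `(3,1,4)`, `(5,1,3)`, `(2,1,9)`, `(5,2,11)`,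
  `(7,2,7)`, `(19,8,45)` (landed kernels `SaturationLadderXPerfect*`, `…GradeOneThirdCert`, `…ChordLadder`, `…AlphaTwoSevenths`),
  the `X`-perfect family `(a,b,c)`, `a + c = qb`, under its entropy condition, the unconditional sub-family
  `(k+1, k, 4^{k+2}k − k − 1)` (`k ≥ 1`), and the near-square family `⟨p^a,p^b,p^a⟩`, `7b ≤ 2a` (the tree's `α ≥ 2/7`;
  Coppersmith's `R(⟨h,h,h^α⟩) = O(h² log² h)`, BCS Thm. (15.51), is the prototype); tight formats add (chain file 1
  `tight_add`), so all their Kronecker products are flat too.  These are the admissible BASES for exact thin certificates.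
Support module beneath stmt-MatrixMultiplication-25909; closes no item; 0 sorry; no definitions; imports only BUILT modules.
[cite: AlmanDuanVassilevskaWilliamsXuXuZhou2025, §3.4 and Thm. 3.2; ChristandlVranaZuiddam2023, Example 1.4 and Prop. 1.6;
LottiRomani1983, §1 (p. 173); HuangPan1998, §2 eq. (2.8); Coppersmith1982, Thm. (BCS 15.51); Strassen1988, §3]
-/

set_option linter.dupNamespace false

noncomputable section

open scoped BigOperators

namespace Summit.MatrixMultiplication.MatrixMultiplication.Theorems.SaturationLadderFlatFormatsItems

open Literature.Computability.AlgebraicComplexity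
open Summit.MatrixMultiplication.MatrixMultiplication.Theses.SaturationLadder (TailDescentTwo SquareFromTwo)
open Summit.MatrixMultiplication.MatrixMultiplication.Theorems.SaturationLadderSpectralFloorLegs
  (matMul_flat_iff_omega_two)  -- landed, imported
open Summit.MatrixMultiplication.MatrixMultiplication.Theorems.SaturationLadderFlatFormats
  (matMul_rect_flat_iff_tight)  -- chain file 1
open Summit.MatrixMultiplication.MatrixMultiplication.Theorems.SaturationLadderXPerfect
  (omegaRect_xPerfect_eq omegaRect_three_one_four omegaRect_five_two_eleven omegaRect_nineteen_eight_fortyfive)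
open Summit.MatrixMultiplication.MatrixMultiplication.Theorems.SaturationLadderGradeOneThirdCert
  (omegaRect_five_one_three_le)
open Summit.MatrixMultiplication.MatrixMultiplication.Theorems.SaturationLadderChordLadder (omegaRect_two_one_nine)
open Summit.MatrixMultiplication.MatrixMultiplication.Theorems.SaturationLadderAlphaTwoSevenths
  (omegaRect_one_mid_one_eq_two omegaRect_seven_two_seven)
open Summit.MatrixMultiplication.MatrixMultiplication.Theorems.SaturationLadderExpSaturation
  (omegaRect_cwFamily_le entropyCondition_four_pow)

variable {K : Type} [Field K]

/-! ## 1. The route's items as flatness of matrix multiplication formats -/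

section RouteItems

/-- **`E_k ⟺ ⟨p^k,p,p⟩ flat`**: `ω(1,k,1) = k + 1` iff `R̃(⟨p^k,p,p⟩) = ζ⁽¹⁾(⟨p^k,p,p⟩)` (`= p^{k+1}`; any `p ≥ 2`).
[cite: AlmanDuanVassilevskaWilliamsXuXuZhou2025, §3.4; ChristandlVranaZuiddam2023, Example 1.4] -/
theorem farExact_iff_flat {p : ℕ} (hp : 2 ≤ p) (k : ℕ) :
    omegaRect K 1 k 1 = (k : ℝ) + 1 ↔
      asymptoticRank (matMulTensor K (p ^ k) (p ^ 1) (p ^ 1)) =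
        flatteningRank (matMulTensor K (p ^ k) (p ^ 1) (p ^ 1)) := by
  rw [matMul_rect_flat_iff_tight hp k 1 1, omegaRect_swap₁₂ K (1 : ℝ) (k : ℝ) 1]
  push_cast
  exact Iff.rfl

/-- **`E₂ ⟺ ⟨p²,p,p⟩ flat`**: `ω(1,2,1) = 3` iff `R̃(⟨p²,p,p⟩) = p³` (`p ≥ 2`). [cite: AlmanDuanVassilevskaWilliamsXuXuZhou2025, §3.4] -/
theorem levelTwo_iff_flat {p : ℕ} (hp : 2 ≤ p) :
    omegaRect K 1 2 1 = 3 ↔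
      asymptoticRank (matMulTensor K (p ^ 2) (p ^ 1) (p ^ 1)) =
        flatteningRank (matMulTensor K (p ^ 2) (p ^ 1) (p ^ 1)) := by
  rw [← farExact_iff_flat hp 2]
  norm_num

/-- **`TailDescentTwo` (stmt-MatrixMultiplication-29474), by name, as a flatness transfer**: for any `p ≥ 2` the item
is equivalent to «some far format `⟨p^k,p,p⟩`, `k ≥ 3`, is flat ⟹ `⟨p²,p,p⟩` is flat» — flat-to-flat, so chain file 1's
floor is silent on it. [cite: AlmanDuanVassilevskaWilliamsXuXuZhou2025, §3.4] -/
theorem tailDescentTwo_iff_flat {p : ℕ} (hp : 2 ≤ p) :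
    TailDescentTwo ↔
      ((∃ k : ℕ, 3 ≤ k ∧ asymptoticRank (matMulTensor ℂ (p ^ k) (p ^ 1) (p ^ 1)) =
          flatteningRank (matMulTensor ℂ (p ^ k) (p ^ 1) (p ^ 1))) →
        asymptoticRank (matMulTensor ℂ (p ^ 2) (p ^ 1) (p ^ 1)) =
          flatteningRank (matMulTensor ℂ (p ^ 2) (p ^ 1) (p ^ 1))) := by
  unfold TailDescentTwo
  rw [levelTwo_iff_flat hp]
  simp_rw [farExact_iff_flat (K := ℂ) hp]

/-- **`SquareFromTwo` (stmt-MatrixMultiplication-29475, the declared residual), by name, as a flatness transfer**: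
`⟨p²,p,p⟩ flat ⟹ ⟨p,p,p⟩ flat` (`p ≥ 2`; gen 25 `matMul_flat_iff_omega_two`). [cite: ChristandlVranaZuiddam2023, Example 1.4 and Prop. 1.6] -/
theorem squareFromTwo_iff_flat {p : ℕ} (hp : 2 ≤ p) :
    SquareFromTwo ↔
      (asymptoticRank (matMulTensor ℂ (p ^ 2) (p ^ 1) (p ^ 1)) =
          flatteningRank (matMulTensor ℂ (p ^ 2) (p ^ 1) (p ^ 1)) →
        asymptoticRank (matMulTensor ℂ p p p) = flatteningRank (matMulTensor ℂ p p p)) := by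
  unfold SquareFromTwo
  rw [levelTwo_iff_flat hp, matMul_flat_iff_omega_two hp, _root_.MatrixMultiplication_iff]

/-- **The summit as flatness** (root form): `MatrixMultiplication ⟺ ⟨p,p,p⟩ flat` (`p ≥ 2`).
[cite: ChristandlVranaZuiddam2023, Example 1.4 and Prop. 1.6] -/
theorem summit_iff_cube_flat {p : ℕ} (hp : 2 ≤ p) :
    _root_.MatrixMultiplication ↔
      asymptoticRank (matMulTensor ℂ p p p) = flatteningRank (matMulTensor ℂ p p p) := by
  rw [matMul_flat_iff_omega_two hp, _root_.MatrixMultiplication_iff]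

/-- **The thin points of `SubexpSaturation` (stmt-MatrixMultiplication-25909) as flatness**: at rational
`(t,r) = (b/a, c/a)` (`a ≥ 1`), `ω(1, b/a, c/a) = 1 + c/a ⟺ ⟨p^a,p^b,p^c⟩ flat` (homogeneity, Lotti–Romani).  The crux
asks for flat THIN formats of every thinness `b/a → 1` with length `c/a ≤ exp(c₀ a/(a−b))`; by chain file 1 each is certified
by powers of flat tensors or by none. [cite: LottiRomani1983, §1 (p. 173); AlmanDuanVassilevskaWilliamsXuXuZhou2025, §3.4] -/
theorem thinExact_iff_flat {p : ℕ} (hp : 2 ≤ p) {a : ℕ} (ha : 1 ≤ a) (b c : ℕ) :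
    omegaRect K 1 ((b : ℝ) / a) ((c : ℝ) / a) = 1 + (c : ℝ) / a ↔
      asymptoticRank (matMulTensor K (p ^ a) (p ^ b) (p ^ c)) =
        flatteningRank (matMulTensor K (p ^ a) (p ^ b) (p ^ c)) := by
  rw [matMul_rect_flat_iff_tight hp a b c]
  have ha0 : (0 : ℝ) < a := by exact_mod_cast ha
  have hhom := LottiRomani1983_homogeneous K ha0.le zero_le_one
    (by positivity : (0 : ℝ) ≤ (b : ℝ) / a) (by positivity : (0 : ℝ) ≤ (c : ℝ) / a)
  rw [mul_one, mul_div_cancel₀ _ ha0.ne', mul_div_cancel₀ _ ha0.ne'] at hhom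
  push_cast
  rw [hhom]
  constructor
  · intro h1
    rw [h1, mul_add, mul_one, mul_div_cancel₀ _ ha0.ne']
  · intro h2
    have : (a : ℝ) * omegaRect K 1 ((b : ℝ) / a) ((c : ℝ) / a) = a * (1 + (c : ℝ) / a) := by
      rw [h2, mul_add, mul_one, mul_div_cancel₀ _ ha0.ne']
    exact mul_left_cancel₀ ha0.ne' this

end RouteItems

/-! ## 2. The tree's unconditionally tight formats are flat tensors -/

section FlatFormats

/-- A tight format gives a flat tensor: `ω(a,b,c) = a + c ⟹ R̃(⟨p^a,p^b,p^c⟩) = ζ⁽¹⁾ = p^{a+c}` (`p ≥ 2`).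
[cite: AlmanDuanVassilevskaWilliamsXuXuZhou2025, §3.4] -/
theorem flat_of_tight {p : ℕ} (hp : 2 ≤ p) {a b c : ℕ} (h : omegaRect K a b c = (a : ℝ) + c) :
    asymptoticRank (matMulTensor K (p ^ a) (p ^ b) (p ^ c)) =
      flatteningRank (matMulTensor K (p ^ a) (p ^ b) (p ^ c)) :=
  (matMul_rect_flat_iff_tight hp a b c).2 (by push_cast; exact h)

/-- **The `X`-perfect family is flat**: `a + c = qb` (`q ≥ 2`, `b ≥ 1`) and the entropy condition of the landed kernel
`SaturationLadderXPerfect` ⟹ `⟨p^a,p^b,p^c⟩` flat for every `p ≥ 2`. [cite: AlmanDuanVassilevskaWilliamsXuXuZhou2025, Thm. 3.2; HuangPan1998, §2 eq. (2.8) (p. 262)] -/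
theorem flat_xPerfect (q a b c : ℕ) (hq : 2 ≤ q) (hb : 1 ≤ b) (hqb : q * b = a + c)
    (hent : 2 * Real.negMulLog (1 / ((q : ℝ) + 2)) + Real.negMulLog (1 - 2 * (1 / ((q : ℝ) + 2))) ≤
      Real.binEntropy (((a : ℝ) + b) / (((q : ℝ) + 2) * b))) {p : ℕ} (hp : 2 ≤ p) :
    asymptoticRank (matMulTensor ℂ (p ^ a) (p ^ b) (p ^ c)) =
      flatteningRank (matMulTensor ℂ (p ^ a) (p ^ b) (p ^ c)) :=
  flat_of_tight hp (omegaRect_xPerfect_eq q a b c hq hb hqb hent)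

/-- **The unconditional sub-family `(k+1, k, 4^{k+2}k − k − 1)`** (`k ≥ 1`; the proved rung `ExpSaturation` of the
route in flatness currency): `⟨p^{k+1}, p^k, p^{4^{k+2}k−k−1}⟩` is flat for every `p ≥ 2`.
[cite: AlmanDuanVassilevskaWilliamsXuXuZhou2025, Thm. 3.2; LeGall2014, Appendix A] -/
theorem flat_cwFamily (k : ℕ) (hk : 1 ≤ k) {p : ℕ} (hp : 2 ≤ p) :
    asymptoticRank (matMulTensor ℂ (p ^ (k + 1)) (p ^ k) (p ^ (4 ^ (k + 2) * k - (k + 1)))) =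
      flatteningRank (matMulTensor ℂ (p ^ (k + 1)) (p ^ k) (p ^ (4 ^ (k + 2) * k - (k + 1)))) := by
  have h16 : 16 ≤ 4 ^ (k + 2) := by
    have := Nat.pow_le_pow_right (by norm_num : 0 < 4) (by omega : 2 ≤ k + 2)
    simpa using this
  have hqk : 4 ^ (k + 2) * k = k + 1 + (4 ^ (k + 2) * k - (k + 1)) := by
    have : k + 1 ≤ 4 ^ (k + 2) * k := by nlinarith
    omega
  have hle := omegaRect_cwFamily_le (4 ^ (k + 2)) k _ (le_trans (by norm_num) h16) hk hqk
    (entropyCondition_four_pow k hk _ rfl)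
  have hlow := add_le_omegaRect₁₃ ℂ (((k + 1 : ℕ)) : ℝ) (k : ℝ) (((4 ^ (k + 2) * k - (k + 1) : ℕ)) : ℝ)
  refine flat_of_tight hp (le_antisymm ?_ ?_)
  · have e : ((4 ^ (k + 2) : ℕ) : ℝ) * k = ((k + 1 : ℕ) : ℝ) + ((4 ^ (k + 2) * k - (k + 1) : ℕ) : ℝ) := by
      exact_mod_cast hqk
    push_cast at hle e ⊢
    linarith
  · push_cast at hlow ⊢
    linarith

/-- `⟨p³,p,p⁴⟩` is flat (`ω(3,1,4) = 7`, tree). [cite: AlmanDuanVassilevskaWilliamsXuXuZhou2025, Thm. 3.2] -/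
theorem flat_three_one_four {p : ℕ} (hp : 2 ≤ p) :
    asymptoticRank (matMulTensor ℂ (p ^ 3) (p ^ 1) (p ^ 4)) =
      flatteningRank (matMulTensor ℂ (p ^ 3) (p ^ 1) (p ^ 4)) :=
  flat_of_tight hp (by rw [show ((3 : ℕ) : ℝ) = 3 by norm_num, show ((1 : ℕ) : ℝ) = 1 by norm_num,
    show ((4 : ℕ) : ℝ) = 4 by norm_num, omegaRect_three_one_four]; norm_num)

/-- `⟨p⁵,p,p³⟩` is flat (`ω(5,1,3) = 8`: the tree's grade-`1/3` certificate and the flattening bound).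
[cite: AlmanDuanVassilevskaWilliamsXuXuZhou2025, Thm. 3.2; HuangPan1998, §2 eq. (2.8) (p. 262)] -/
theorem flat_five_one_three {p : ℕ} (hp : 2 ≤ p) :
    asymptoticRank (matMulTensor ℂ (p ^ 5) (p ^ 1) (p ^ 3)) =
      flatteningRank (matMulTensor ℂ (p ^ 5) (p ^ 1) (p ^ 3)) := by
  refine flat_of_tight hp (le_antisymm ?_ ?_)
  · have h := omegaRect_five_one_three_le
    push_cast
    linarith
  · have h := add_le_omegaRect₁₃ ℂ (5 : ℝ) 1 3
    push_cast
    linarith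

/-- `⟨p²,p,p⁹⟩` is flat (`ω(2,1,9) = 11`, tree). [cite: LottiRomani1983, §1 (p. 173); HuangPan1998, §2 eq. (2.8) (p. 262)] -/
theorem flat_two_one_nine {p : ℕ} (hp : 2 ≤ p) :
    asymptoticRank (matMulTensor ℂ (p ^ 2) (p ^ 1) (p ^ 9)) =
      flatteningRank (matMulTensor ℂ (p ^ 2) (p ^ 1) (p ^ 9)) :=
  flat_of_tight hp (by have h := omegaRect_two_one_nine; push_cast; linarith)

/-- `⟨p⁵,p²,p¹¹⟩` is flat (`ω(5,2,11) = 16`, tree). [cite: AlmanDuanVassilevskaWilliamsXuXuZhou2025, Thm. 3.2] -/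
theorem flat_five_two_eleven {p : ℕ} (hp : 2 ≤ p) :
    asymptoticRank (matMulTensor ℂ (p ^ 5) (p ^ 2) (p ^ 11)) =
      flatteningRank (matMulTensor ℂ (p ^ 5) (p ^ 2) (p ^ 11)) :=
  flat_of_tight hp (by have h := omegaRect_five_two_eleven; push_cast; linarith)

/-- `⟨p¹⁹,p⁸,p⁴⁵⟩` is flat (`ω(19,8,45) = 64`, tree). [cite: AlmanDuanVassilevskaWilliamsXuXuZhou2025, Thm. 3.2] -/
theorem flat_nineteen_eight_fortyfive {p : ℕ} (hp : 2 ≤ p) :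
    asymptoticRank (matMulTensor ℂ (p ^ 19) (p ^ 8) (p ^ 45)) =
      flatteningRank (matMulTensor ℂ (p ^ 19) (p ^ 8) (p ^ 45)) :=
  flat_of_tight hp (by have h := omegaRect_nineteen_eight_fortyfive; push_cast; linarith)

/-- `⟨p⁷,p²,p⁷⟩` is flat (`ω(7,2,7) = 14`, the tree's `α ≥ 2/7`). [cite: LottiRomani1983, §1 (p. 173); HuangPan1998, §2 eq. (2.8) (p. 262)] -/
theorem flat_seven_two_seven {p : ℕ} (hp : 2 ≤ p) :
    asymptoticRank (matMulTensor ℂ (p ^ 7) (p ^ 2) (p ^ 7)) =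
      flatteningRank (matMulTensor ℂ (p ^ 7) (p ^ 2) (p ^ 7)) :=
  flat_of_tight hp (by have h := omegaRect_seven_two_seven; push_cast; linarith)

/-- **The near-square family is flat**: `⟨p^a,p^b,p^a⟩` (`a ≥ 1`, `7b ≤ 2a`, `p ≥ 2`) — Coppersmith's
`R(⟨h,h,h^β⟩) = O(h² log² h)` for small `β` in asymptotic-rank currency, with the tree's `ω(1,t,1) = 2` for `t ≤ 2/7`.
[cite: LeGall2012, §1; LottiRomani1983, §1 (p. 173)] -/
theorem flat_nearSquare {a b : ℕ} (ha : 1 ≤ a) (hab : 7 * b ≤ 2 * a) {p : ℕ} (hp : 2 ≤ p) :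
    asymptoticRank (matMulTensor ℂ (p ^ a) (p ^ b) (p ^ a)) =
      flatteningRank (matMulTensor ℂ (p ^ a) (p ^ b) (p ^ a)) := by
  refine (thinExact_iff_flat hp ha b a).1 ?_
  have ha0 : (0 : ℝ) < a := by exact_mod_cast ha
  have ht : (b : ℝ) / a ≤ 2 / 7 := by
    rw [div_le_iff₀ ha0]
    have : (7 : ℝ) * b ≤ 2 * a := by exact_mod_cast hab
    linarith
  rw [div_self ha0.ne', omegaRect_one_mid_one_eq_two ht]
  norm_num

end FlatFormats

end Summit.MatrixMultiplication.MatrixMultiplication.Theorems.SaturationLadderFlatFormatsItems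

end
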